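import Summits.CriticalPhenomena.PercolationContinuityZ3.Theorems.PercNearOneGluingNoHeavyLowerTailHullPortMarkerDominanceTools
import HarnessLib
import HarnessLib.Audit.Tags

/-!
# Set-marker dominance without avoidance (LEMMA MDL⁺(∅))  (PAPER-2 track (ii): constants of the CSH family)

builds on p205010 (kernel theorem, internal audit signed; external expert review pending).  Support file (`--supports
stmt-CriticalPhenomena-4575`), seat `prim-consts-2` (gen 7); rows A6/A11 of `run/shared/lean/prim/consts/CONSTANTS.md`; memo
`run/shared/lean/prim/consts/FROM-prim-consts-2-g7-ROW-SPLIT.md` §11.  No definitions, no named facts, no sorries; standard axioms.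

`Consts.setMarkerDominance_noAvoid` — bond percolation `μ = prodBernoulli w` on a finite vertex type, `s, y, z` with `s ≠ y`, `s ≠ z`,
`F` a monotone nonnegative function of the open edge cluster `C_s`; `Y = {s ↔ y}`, `Z = {s ↔ z}`, `N' = {s ↮ y} ∩ {s ↮ z}`, `W = {y ↔ z}`:
`μ(W ∩ N') · [∫_{Y ∪ Z} F − (∫F) μ(Y ∪ Z)] ≤ μ(N') · [∫_Z F − (∫F) μ(Z)]`,
i.e. **`Cov(F(C_s), 1_Z) ≥ μ(y ↔ z | s ↮ {y,z}) · Cov(F(C_s), 1_{Y ∪ Z})`**: the marker `z` is at least `P(y↔z | s↮y,z)` times as correlated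
with every increasing function of the cluster as the SET marker `{y,z}` ("`C_s` meets `{y,z}`").  This is the `X = ∅` marker dominance lemma
(`HullPort.markerDominance_noAvoid`, marker `y` in place of `{y,z}`, factor `P(y↔z | s↮y)`) with the same two-line proof: with `B = Z ∪ W`,
`1_Z = 1_B − 1_{W ∩ N'}`, so `μ(N')Cov(F,1_Z) − μ(WN')Cov(F,1_{Y∪Z}) = μ(N')·[∫_B F − (∫F)μ(B)] + [μ(WN')∫_{N'} F − μ(N')∫_{W∩N'} F]`; the first bracket
is `≥ 0` by Harris, the second by vdBHK Thm 1.3 given `{s ↮ {y,z}}` (`setSep_offCluster_negCorrelation` with the avoided SET `{y,z}`).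
Use (memo §11): at `F = 1{u ∈ C_x}` it is the between-world step of the chain minor with the avoided vertex pendant at `u`
(`Consts.chainMinor_uAvoid_noTarget`), completing the proof of the single-edge chain rule for every avoided vertex attached only to `x,u,v,o`.
Not in print; derived here. [cite: VandenbergHaggstromKahn2005, Thm. 1.3 (p. 6) — corollary, derived here] [cite: Grimmett1999, Thm. (2.4) p. 34]
-/

noncomputable section

namespace Summit.CriticalPhenomena.PercolationContinuityZ3.Theorems

open MeasureTheory Set Literature.Probability.LatticeModels Literature.Probability.Percolation
open scoped Classical

namespace Consts

open LonePortSum LonePortSumGeneral BHK2006 DecisionTree KNPreFKG HullPort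

variable {V : Type*}

/-- **Set-marker dominance, `X = ∅` (functional form).**  For `s ≠ y`, `s ≠ z`, `F` monotone nonnegative on the open edge cluster of `s`,
`Y = {s ↔ y}`, `Z = {s ↔ z}`, `N' = Yᶜ ∩ Zᶜ`, `W = {y ↔ z}`:
`μ(N' ∩ W) · [∫_{Y∪Z} F(C_s) − (∫ F(C_s)) μ(Y∪Z)] ≤ μ(N') · [∫_Z F(C_s) − (∫ F(C_s)) μ(Z)]`.
Harris for `B = Z ∪ W` plus vdBHK Thm 1.3 given `{s ↮ {y,z}}` for `F(C_s)` and the off-cluster statistic `1_W`.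
[cite: VandenbergHaggstromKahn2005, Thm. 1.3 (p. 6) — corollary, derived here] -/
theorem setMarkerDominance_noAvoid [Fintype V] (w : Sym2 V → unitInterval) (s y z : V) (hsy : s ≠ y) (hsz : s ≠ z)
    (F : Set (Sym2 V) → ℝ) (hF : Monotone F) (hF0 : ∀ C, 0 ≤ F C) :
    (prodBernoulli w).real ((openConn s y : Set (BondConfig V))ᶜ ∩ (openConn s z : Set (BondConfig V))ᶜ ∩ openConn y z) *
        ((∫ ω in (openConn s y ∪ openConn s z : Set (BondConfig V)), F (openEdgeCluster ω s) ∂(prodBernoulli w)) -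
          (∫ ω, F (openEdgeCluster ω s) ∂(prodBernoulli w)) *
            (prodBernoulli w).real (openConn s y ∪ openConn s z : Set (BondConfig V))) ≤
      (prodBernoulli w).real ((openConn s y : Set (BondConfig V))ᶜ ∩ (openConn s z : Set (BondConfig V))ᶜ) *
        ((∫ ω in (openConn s z : Set (BondConfig V)), F (openEdgeCluster ω s) ∂(prodBernoulli w)) -
          (∫ ω, F (openEdgeCluster ω s) ∂(prodBernoulli w)) *
            (prodBernoulli w).real (openConn s z : Set (BondConfig V))) := by
  classical
  set μ := prodBernoulli w with hμ
  have hmeas : ∀ S : Set (BondConfig V), MeasurableSet S := fun S => MeasurableSet.of_discrete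
  set Y : Set (BondConfig V) := openConn s y with hY
  set Z : Set (BondConfig V) := openConn s z with hZ
  set W : Set (BondConfig V) := openConn y z with hW
  set N : Set (BondConfig V) := Yᶜ ∩ Zᶜ with hN
  set f : BondConfig V → ℝ := fun ω => F (openEdgeCluster ω s) with hf
  have hfmono : Monotone f := fun ω ω' h => hF (openEdgeCluster_mono h s)
  have hf0 : ∀ ω, 0 ≤ f ω := fun ω => hF0 _
  have hint : ∀ S : Set (BondConfig V), IntegrableOn f S μ := fun S => (Integrable.of_finite).integrableOn
  -- `Z ∪ W = Z ⊔ (W ∩ N)` and `N = (Y ∪ Z)ᶜ`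
  have hWN : W ∩ N = W \ Z := by
    ext ω
    simp only [hW, hN, hZ, hY, mem_inter_iff, mem_compl_iff, mem_sdiff]
    constructor
    · rintro ⟨hyz, -, hsz'⟩
      exact ⟨hyz, hsz'⟩
    · rintro ⟨hyz, hsz'⟩
      refine ⟨hyz, fun hsy' => hsz' ((hsy' : (openGraph ω).Reachable s y).trans
        (hyz : (openGraph ω).Reachable y z)), hsz'⟩
  have hBdisj : Disjoint Z (W ∩ N) := by
    rw [hWN]; exact disjoint_sdiff_right
  have hBunion : Z ∪ W = Z ∪ (W ∩ N) := by rw [hWN, union_sdiff_self]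
  have hNc : N = (Y ∪ Z)ᶜ := by rw [hN, compl_union]
  -- the set `B = Z ∪ W` is increasing
  have hBup : IsUpperSet (Z ∪ W) := (isUpperSet_openConn s z).union (isUpperSet_openConn y z)
  -- integrals and masses
  have iB : ∫ ω in Z ∪ W, f ω ∂μ = (∫ ω in Z, f ω ∂μ) + ∫ ω in W ∩ N, f ω ∂μ := by
    rw [hBunion]; exact setIntegral_union hBdisj (hmeas _) (hint _) (hint _)
  have mB : μ.real (Z ∪ W) = μ.real Z + μ.real (W ∩ N) := by
    rw [hBunion]; exact measureReal_union hBdisj (hmeas _)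
  have iYZ : (∫ ω in Y ∪ Z, f ω ∂μ) + ∫ ω in N, f ω ∂μ = ∫ ω, f ω ∂μ := by
    rw [hNc]; exact integral_add_compl (hmeas _) Integrable.of_finite
  have mYZ : μ.real (Y ∪ Z) + μ.real N = 1 := by
    have := measureReal_add_measureReal_compl (μ := μ) (hmeas (Y ∪ Z)); rwa [probReal_univ, ← hNc] at this
  have iWN : ∫ ω in N, f ω * W.indicator 1 ω ∂μ = ∫ ω in W ∩ N, f ω ∂μ := by
    have e : (fun ω => f ω * W.indicator (1 : BondConfig V → ℝ) ω) = W.indicator f := by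
      funext ω
      by_cases hω : ω ∈ W
      · rw [indicator_of_mem hω, indicator_of_mem hω, Pi.one_apply, mul_one]
      · rw [indicator_of_notMem hω, indicator_of_notMem hω, mul_zero]
    rw [e, setIntegral_indicator (hmeas W), inter_comm]
  -- (a) Harris: `(∫ f) μ(B) ≤ ∫_B f`
  have ha : (∫ ω, f ω ∂μ) * μ.real (Z ∪ W) ≤ ∫ ω in Z ∪ W, f ω ∂μ := by
    have h := integral_harris w f ((Z ∪ W).indicator 1) hfmono
      (monotone_indicator_one_of_isUpperSet hBup) hf0 (fun ω => indicator_nonneg (fun _ _ => zero_le_one) _)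
    rw [integral_indicator_one (hmeas _)] at h
    have e : ∫ ω, f ω * (Z ∪ W).indicator 1 ω ∂μ = ∫ ω in Z ∪ W, f ω ∂μ := by
      rw [← integral_indicator (hmeas _)]
      refine integral_congr_ae (Filter.Eventually.of_forall fun ω => ?_)
      by_cases hω : ω ∈ Z ∪ W
      · simp [indicator_of_mem hω]
      · simp [indicator_of_notMem hω]
    rw [e] at h
    exact h
  -- (b) off-cluster negative correlation given `{s ↮ {y, z}}`
  have hsX : s ∉ ({y, z} : Set V) := by
    simp only [mem_insert_iff, mem_singleton_iff, not_or]; exact ⟨hsy, hsz⟩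
  have hNeq : {ω : BondConfig V | ∀ x ∈ ({y, z} : Set V), ¬ (openGraph ω).Reachable s x} = N := by
    ext ω
    simp only [mem_setOf_eq, mem_insert_iff, mem_singleton_iff, forall_eq_or_imp, forall_eq, hN, hY, hZ, mem_inter_iff,
      mem_compl_iff]
    rfl
  have hb := setSep_offCluster_negCorrelation w s ({y, z} : Set V) hsX F hF (W.indicator 1)
    (monotone_indicator_one_of_isUpperSet (isUpperSet_openConn y z)) (fun ω hω => by
      have hns : ¬ (openGraph ω).Reachable s y := hω y (mem_insert _ _)
      have key : (ω \ {e | ∃ v ∈ e, v = s ∨ ∃ e' ∈ openEdgeCluster ω s, v ∈ e'}) ∈ W ↔ ω ∈ W :=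
        LonePortSumGeneral.reachable_sdiff_bar_iff hns z
      by_cases hyz : ω ∈ W
      · rw [indicator_of_mem hyz, indicator_of_mem (key.2 hyz), Pi.one_apply, Pi.one_apply]
      · rw [indicator_of_notMem hyz, indicator_of_notMem (mt key.1 hyz)])
  rw [hNeq] at hb
  change μ.real N * ∫ ω in N, f ω * W.indicator 1 ω ∂μ ≤ (∫ ω in N, f ω ∂μ) * ∫ ω in N, W.indicator 1 ω ∂μ at hb
  rw [iWN, setIntegral_indicator_one_eq] at hb
  -- assemble
  have hN0 : 0 ≤ μ.real N := measureReal_nonneg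
  have hNW : μ.real (N ∩ W) = μ.real (W ∩ N) := by rw [inter_comm]
  have hNW' : μ.real (Yᶜ ∩ Zᶜ ∩ W) = μ.real (W ∩ N) := by rw [← hN, inter_comm]
  rw [hNW] at hb
  rw [hNW']
  have mYZ' : μ.real (Y ∪ Z) = 1 - μ.real N := by linarith
  have ident : μ.real N * ((∫ ω in Z, f ω ∂μ) - (∫ ω, f ω ∂μ) * μ.real Z) -
      μ.real (W ∩ N) * ((∫ ω in Y ∪ Z, f ω ∂μ) - (∫ ω, f ω ∂μ) * μ.real (Y ∪ Z)) =
      μ.real N * ((∫ ω in Z ∪ W, f ω ∂μ) - (∫ ω, f ω ∂μ) * μ.real (Z ∪ W)) +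
        (μ.real (W ∩ N) * (∫ ω in N, f ω ∂μ) - μ.real N * ∫ ω in W ∩ N, f ω ∂μ) := by
    rw [mYZ', ← iYZ, iB, mB]; ring
  have ha' := mul_le_mul_of_nonneg_left ha hN0
  have h1 : 0 ≤ μ.real N * ((∫ ω in Z ∪ W, f ω ∂μ) - (∫ ω, f ω ∂μ) * μ.real (Z ∪ W)) := by
    nlinarith [ha', hN0]
  have h2 : 0 ≤ μ.real (W ∩ N) * (∫ ω in N, f ω ∂μ) - μ.real N * ∫ ω in W ∩ N, f ω ∂μ := by
    linarith [hb]
  linarith [ident, h1, h2]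

end Consts

end Summit.CriticalPhenomena.PercolationContinuityZ3.Theorems

end
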